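/-
Copyright (c) 2026. All rights reserved.
Released under Apache 2.0 license as described in the file LICENSE.
Authors: abc-iut cell, prover seat abc-iut-w5-d144 (gen 6; row «COR510iv-SB′», brick E input «D1b»), over abc-iut-L4-t3's
`IotaOver` / `LamOverLink` add-ons, abc-iut-f-101's `logObsFamily` and this seat's `DiagramChainFamiliesOver.lean`.
-/
import Literature.AnabelianGeometry.AbsoluteAnabelian.DiagramChainFamiliesOver
import Literature.AnabelianGeometry.AbsoluteAnabelian.DiagramOverTransport
import Literature.AnabelianGeometry.AbsoluteAnabelian.Ltimes.LogFrobeniusObservablesOfIotaSquare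
import HarnessLib

/-!
# [AbsTopIII] Cor 5.5 (iii) / Def 5.4 (iv)(vii): the homotopies of the observable `S_log⊞_v` lie over `Th•[Z]`

S. Mochizuki, *Topics in absolute anabelian geometry III: global reconstruction algorithms*,
J. Math. Sci. Univ. Tokyo 22 (2015) 939–1156 [MochizukiAbsTopIII2015]; manuscript `paper:url-5493eb38cbb7`: Def 5.4 (iv)
p. 127 ("`λ⊞_{v,ν}` … lie over `Th•[Z]`"), (vii) p. 128 (the `ι⊞_{v,ε}`), (ii) p. 125 ("`log•_{T,T}` lies over `Th•`"), Cor 5.5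
p. 130 (the diagram `D•`, proviso on the space-link / post-log vertices), (iii) p. 131 (the observable `S_log⊞_v`), Rmk
3.5.1 p. 78 (structure functors: «a 'constant portion' … 'under the entire diagram'»).

WHAT.  The observable's diagram `D•_{≤2} ∪ {𝒩⊞_v}` (`logDiagramPlus v`) LIES OVER `Th•[Z] = ℰ•` through the structure
functors `𝒳_⋎, □ ↦ proj`, `𝒩⊞_v ↦ (𝒩⊞_v → 𝒩_v → Th•[Z])`, the arrows lying over by the interface's own isomorphisms
`logOver` (`log`), the unitor (`id_⋎`), `lamOver v ν` (`λ⊞_{v,ν}`): `logPlusOverE v` (abc-iut-L4-t12's `OverData`).  With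
respect to it:

* `isOver_logGenHom` — GIVEN abc-iut-L4-t3's add-ons `IotaOver` (the `ι⊞` lie over `Th•[Z]`) and `LamOverLink` (one
  over-structure at the identified space-link / post-log vertices), BOTH printed kinds of generator pairs of `S_log⊞_v`
  (abc-iut-f-101's `LogGen.pre` / `LogGen.post`, homotopy `logGenHom` = `ι⊞_{v,ε}` re-typed) carry OVER-homotopies
  (abc-iut-f-101's `OverData.IsOver`): the component computation of abc-iut-f-102's THEOREM B (`hpre` / `hpost`), here
  against the observable's own small over-datum (abc-iut-L4-t3's `IotaOver.toE_map_iota_heq_of_preLog` / `_spaceLink`);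
* `isOver_logObsFamily_η` — ★ hence EVERY homotopy of the constructed observable `logObsFamily v hsq` lies over `Th•[Z]`
  (this seat's `isOver_chainFamily_η`): the hypothesis «hover⊞» of the Cor 5.10 (iv)(b) compatibility closer (row
  «COR510iv-SB′», abc-iut-f-101's brick D2) in over-datum form, for every setting satisfying the two add-ons;
* `isOver_logObsFamily_η_map` — the same over any category under `Th•[Z]` (abc-iut-f-101's `IsOver.map`,
  `DiagramOverTransport.lean`; e.g. along `ℰ• → ℰ⊢ ⥲ An⊢[𝒩⊢⊞]` of Cor 5.10 (iv)).

Interface-level (hypotheses `IotaOver`, `LamOverLink`, `IotaSquaresCommute`; no carrier); nothing here bears on [IUTchIII]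
Cor. 3.12; no side taken; typed ≠ proved.

**`⋉`-TWIN (cell row «LTIMES-SUCCESSOR», L4-lead m162; typing finding T3g9-F1).**  This file is the verbatim
re-elaboration of `LogFrobeniusObservablesOver.lean` over the successor interface `LogFrobeniusSettingLtimes`
(`Ltimes/LogFrobeniusCompatibility.lean`: `ι⊞_{v,ε}` indexed by the edges of `Γ⃗^⋉_v` at EVERY place, [AbsTopIII] Cor 5.5 (iii)
p. 131), produced by the cell recipe `LTIMES-RECIPE.md`: names carry over inside `namespace LogFrobeniusSettingLtimes`, the
section variable is `Lt`, setting-independent declarations are NOT repeated (the originals are in scope), statements and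
proofs are otherwise unchanged.  The original file over the frozen interface stays as it is.
SLICE T9 «LTIMES-OBSERVABLES» (abc-iut-f-101 gen 6): THIS TWIN CARRIES ONLY §1 — the over-`Th•[Z]` datum `logPlusOverE`
(`plusN`, `plusμ`, `plusμObs`) consumed by the bridge `Ltimes/LogFrobeniusMonoTelecoreObservablesOverBridge`; the componentwise
structure isomorphisms and the over-ness of the generator homotopies (`isOver_logGenHom`, `isOver_logObsFamily_η(_map)`, which
need the `⋉`-twins of `IotaOver`/`LamOverLink`) belong to the E-style instance slice and are NOT re-elaborated here.
-/

universe u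

open CategoryTheory Quiver

namespace Literature.AnabelianGeometry.AbsoluteAnabelian

namespace LogFrobeniusSettingLtimes

variable {Vmod : Type u} {isArc : Vmod → Bool} (Lt : LogFrobeniusSettingLtimes Vmod isArc) (v : Vmod)

/-! ## The observable's diagram over `Th•[Z]` -/

/-- Structure functor of a vertex of `D•_{≤2}` towards `Th•[Z] = ℰ•`: `𝒳_⋎ ↦ proj`, `□ ↦ proj` (the other vertices of `D•⊢`
do not occur in `D•_{≤2}`). [cite: MochizukiAbsTopIII2015, Remark 3.5.1 p.78] -/
def plusN : (x : DVertex Vmod isArc) → x.InFirstRows 2 → (x.categoryLtimes Lt ⥤ Lt.E)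
  | .row1 _, _ => Lt.proj
  | .core, _ => Lt.proj
  | .nplus _, h => absurd h.2 (by change ¬ (3 ≤ 2); decide)
  | .nv _, h => absurd h.2 (by change ¬ (4 ≤ 2); decide)
  | .e5, h => absurd h.2 (by change ¬ (5 ≤ 2); decide)
  | .an, h => absurd h.2 (by change ¬ (6 ≤ 2); decide)
  | .e7, h => absurd h.2 (by change ¬ (7 ≤ 2); decide)
  | .nmonoPlus _, h => h.1.elim
  | .nmono _, h => h.1.elim
  | .emono5, h => h.1.elim
  | .anMono, h => h.1.elim
  | .emono7, h => h.1.elim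

/-- The arrows of `D•_{≤2}` lie over `Th•[Z]`: `log` by `logOver` (Def 5.4 (ii)), `id_⋎` by the unitor.
[cite: MochizukiAbsTopIII2015, Def 5.4 (ii) p. 125] -/
def plusμ : ∀ {x y : DVertex Vmod isArc} (e : DEdge isArc x y) (hx : x.InFirstRows 2) (hy : y.InFirstRows 2),
    DEdge.functorLtimes Lt e ⋙ Lt.plusN y hy ≅ Lt.plusN x hx
  | _, _, .log _, _, _ => Lt.logOver
  | _, _, .toCore _, _, _ => Lt.proj.leftUnitor
  | _, _, .lam _ _ _, _, hy => absurd hy.2 (by change ¬ (3 ≤ 2); decide)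
  | _, _, .forget _, hx, _ => absurd hx.2 (by change ¬ (3 ≤ 2); decide)
  | _, _, .toE _, hx, _ => absurd hx.2 (by change ¬ (4 ≤ 2); decide)
  | _, _, .κAn, hx, _ => absurd hx.2 (by change ¬ (5 ≤ 2); decide)
  | _, _, .anToE, hx, _ => absurd hx.2 (by change ¬ (6 ≤ 2); decide)
  | _, _, .monoNplus _, hx, _ => absurd hx.2 (by change ¬ (3 ≤ 2); decide)
  | _, _, .monoN _, hx, _ => absurd hx.2 (by change ¬ (4 ≤ 2); decide)
  | _, _, .monoE5, hx, _ => absurd hx.2 (by change ¬ (5 ≤ 2); decide)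
  | _, _, .monoAn, hx, _ => absurd hx.2 (by change ¬ (6 ≤ 2); decide)
  | _, _, .monoE7, hx, _ => absurd hx.2 (by change ¬ (7 ≤ 2); decide)
  | _, _, .forgetMono _, hx, _ => hx.1.elim
  | _, _, .toEmono _, hx, _ => hx.1.elim
  | _, _, .κAnMono, hx, _ => hx.1.elim
  | _, _, .anMonoToE, hx, _ => hx.1.elim

/-- The observation arrows `λ⊞_{v,ν} : □ → 𝒩⊞_v` lie over `Th•[Z]` by `lamOver v ν` (Def 5.4 (iv)).
[cite: MochizukiAbsTopIII2015, Def 5.4 (iv) p. 127] -/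
def plusμObs : ∀ {x : DVertex Vmod isArc} (i : DEdge isArc x (.nplus v)) (hx : x.InFirstRows 2),
    DEdge.functorLtimes Lt i ⋙ (Lt.forget v ⋙ Lt.toE v) ≅ Lt.plusN x hx
  | _, .lam _ ν _, _ => Lt.lamOver v ν

/-- **The observable's diagram `D•_{≤2} ∪ {𝒩⊞_v}` over `Th•[Z]`** (abc-iut-L4-t12's `OverData`): structure functors
`proj` on `D•_{≤2}` and `𝒩⊞_v → 𝒩_v → Th•[Z]` at the observation vertex; over-isomorphisms `logOver`, unitor, `lamOver`.
[cite: MochizukiAbsTopIII2015, Remark 3.5.1 p.78] -/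
def logPlusOverE : (Lt.logDiagramPlus v).OverData Lt.E where
  N a := match a with
    | ExtVertex.base a => Lt.plusN a.1 a.2
    | ExtVertex.obs => Lt.forget v ⋙ Lt.toE v
  μ {a b} e := match a, b, e with
    | ExtVertex.base a, ExtVertex.base b, e => Lt.plusμ e a.2 b.2
    | ExtVertex.base a, ExtVertex.obs, i => Lt.plusμObs v i a.2
    | ExtVertex.obs, ExtVertex.base _, j => PEmpty.elim j
    | ExtVertex.obs, ExtVertex.obs, e => PEmpty.elim e

/-- The structure functor at the observation vertex is `𝒩⊞_v → 𝒩_v → Th•[Z]`. [cite: MochizukiAbsTopIII2015, Remark 3.5.1 p.78] -/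
@[simp] theorem logPlusOverE_N_obs : (Lt.logPlusOverE v).N (logShapePlus (isArc := isArc) v).obs = (Lt.forget v ⋙ Lt.toE v) := rfl

/-- The structure functor at `□` is `proj`. [cite: MochizukiAbsTopIII2015, Remark 3.5.1 p.78] -/
@[simp] theorem logPlusOverE_N_core :
    (Lt.logPlusOverE v).N ((logShapePlus (isArc := isArc) v).base ⟨.core, core_mem_two⟩) = Lt.proj := rfl

/-- The structure functor at `𝒳_⋎` is `proj`. [cite: MochizukiAbsTopIII2015, Remark 3.5.1 p.78] -/
@[simp] theorem logPlusOverE_N_row1 (n : ℤ) :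
    (Lt.logPlusOverE v).N ((logShapePlus (isArc := isArc) v).base ⟨.row1 n, row1_mem_two n⟩) = Lt.proj := rfl

/-- The over-isomorphism of `λ⊞_{v,ν}` is `lamOver v ν`. [cite: MochizukiAbsTopIII2015, Def 5.4 (iv) p. 127] -/
@[simp] theorem logPlusOverE_μ_lamEdge (ν : LogVertex (isArc v)) (hν : ν.isPostLog = false) :
    (Lt.logPlusOverE v).μ (lamEdge v ν hν) = Lt.lamOver v ν := rfl

/-- The over-isomorphism of `id_⋎` is the unitor. [cite: MochizukiAbsTopIII2015, Cor 5.5 p. 130] -/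
@[simp] theorem logPlusOverE_μ_toCoreEdge (n : ℤ) : (Lt.logPlusOverE v).μ (toCoreEdge v n) = Lt.proj.leftUnitor := rfl

/-- The over-isomorphism of `log` is `logOver`. [cite: MochizukiAbsTopIII2015, Def 5.4 (ii) p. 125] -/
@[simp] theorem logPlusOverE_μ_logEdge (n : ℤ) : (Lt.logPlusOverE v).μ (logEdge v n) = Lt.logOver := rfl

end LogFrobeniusSettingLtimes

end Literature.AnabelianGeometry.AbsoluteAnabelian
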